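import Summits.AtomisticToContinuum.Crystallization.Theorems.ThreeConeCertificateSlackRigidityRodLemmaE

/-!
# The 1-D spectral lemma of line `signed-root-silent-field` — the registered stub `stub_rodLemma`

The registered stub `stub_rodLemma` (skeleton `Cruxes/SlackRigidity/Lines/signed-root-silent-field.lean`,
lead c2; crux `SlackRigidity`, stmt-AtomisticToContinuum-11960): a bounded sequence `u : ℤ → ℂ` with
`Σ_k u_k c(t − kh) = 0` for all real `t`, where `c` is continuous, `O((1+|t|)⁻²)`, and `𝓕c` is `C²`
and zero-free on `(1/(2h), 1/h) ∪ (−1/h, −1/(2h))`, is `2`-periodic.  Proof WITHOUT Wiener division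
or distributions: test the identity against `𝓕(φ/𝓕c)` (multiplication formula) to annihilate every
`C_c²` test function supported in a good interval; integer translates of the two good intervals cover
`ℝ ∖ ½ℤ`; shrinking bumps extend the annihilation to test functions with vanishing `2`-jets on `½ℤ`;
pairing with `𝐞(k₀·)(𝐞(2·) − 1)³ Q₀` (`𝓕Q₀|_ℤ = q δ₀`) gives a vanishing third difference of
`n ↦ u(k₀ + 2n)`, and a bounded sequence with vanishing third difference is constant.
All `[folklore]` (Rudin, *Functional Analysis* Thm 9.3; Katznelson, *Harmonic Analysis* Ch. VI).

This file: a bounded sequence on `ℤ` with vanishing third difference is constant; the lemma at unit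
spacing (`rodLemma_one`); the dilation formula `𝓕(c(h·))(ξ) = h⁻¹𝓕c(ξ/h)`; and the registered stub
at general spacing `h > 0`.
-/

noncomputable section

open scoped BigOperators Topology FourierTransform Real
open MeasureTheory Filter Set Complex

namespace Summit.AtomisticToContinuum.Crystallization.Theorems.SignedRootRodLemma

/-- A bounded affine sequence `n ↦ a + n c` has `c = 0`. [folklore] -/
theorem slope_eq_zero_of_bounded {a c : ℂ} {K : ℝ} (h : ∀ n : ℤ, ‖a + n * c‖ ≤ K) : c = 0 := by
  by_contra hc
  have hcpos : 0 < ‖c‖ := norm_pos_iff.2 hc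
  obtain ⟨n, hn⟩ := exists_nat_gt ((K + ‖a‖) / ‖c‖)
  have h1 : (n : ℝ) * ‖c‖ ≤ K + ‖a‖ := by
    have h2 := h n
    have h3 : ‖((n : ℤ) : ℂ) * c‖ ≤ ‖a + ((n : ℤ) : ℂ) * c‖ + ‖a‖ := by
      calc ‖((n : ℤ) : ℂ) * c‖ = ‖(a + ((n : ℤ) : ℂ) * c) - a‖ := by ring_nf
        _ ≤ ‖a + ((n : ℤ) : ℂ) * c‖ + ‖a‖ := norm_sub_le _ _
    have h4 : ‖((n : ℤ) : ℂ) * c‖ = (n : ℝ) * ‖c‖ := by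
      rw [norm_mul]; simp
    linarith
  have h5 := (div_lt_iff₀ hcpos).1 hn
  linarith

/-- **A bounded sequence on `ℤ` with vanishing third difference is constant** (hence in particular
`1`-periodic): `w(n+3) − 3w(n+2) + 3w(n+1) − w(n) = 0` and `‖w‖ ≤ B` force `w(n+1) = w(n)`. [folklore] -/
theorem succ_eq_of_third_difference_zero {w : ℤ → ℂ} {B : ℝ} (hb : ∀ n, ‖w n‖ ≤ B)
    (h3 : ∀ n, w (n + 3) - 3 * w (n + 2) + 3 * w (n + 1) - w n = 0) : ∀ n, w (n + 1) = w n := by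
  set d : ℤ → ℂ := fun n => w (n + 1) - w n with hd
  set e : ℤ → ℂ := fun n => d (n + 1) - d n with he
  -- `e` is constant
  have he1 : ∀ n, e (n + 1) = e n := by
    intro n
    have := h3 n
    simp only [he, hd]
    rw [show n + 1 + 1 + 1 = n + 3 by ring, show n + 1 + 1 = n + 2 by ring]
    linear_combination this
  have hec : ∀ n, e n = e 0 := by
    intro n
    induction n using Int.induction_on with
    | zero => rfl
    | succ k ih => rw [he1, ih]
    | pred k ih =>
      have := he1 (-(k : ℤ) - 1)
      rw [show -(k : ℤ) - 1 + 1 = -k by ring] at this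
      rw [← ih, ← this]
  -- `d` is affine
  have hdaff : ∀ n, d n = d 0 + n * e 0 := by
    intro n
    induction n using Int.induction_on with
    | zero => simp
    | succ k ih =>
      have h1 : d ((k : ℤ) + 1) = d k + e k := by simp only [he]; ring
      rw [h1, ih, hec (k : ℤ)]; push_cast; ring
    | pred k ih =>
      have h1 : d (-(k : ℤ) - 1) = d (-(k : ℤ)) - e (-(k : ℤ) - 1) := by
        simp only [he]; rw [show -(k : ℤ) - 1 + 1 = -k by ring]; ring
      rw [h1, ih, hec (-(k : ℤ) - 1)]; push_cast; ring
  -- `d` is bounded, so `e 0 = 0`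
  have hdb : ∀ n, ‖d n‖ ≤ 2 * B := fun n => by
    calc ‖d n‖ = ‖w (n + 1) - w n‖ := rfl
      _ ≤ ‖w (n + 1)‖ + ‖w n‖ := norm_sub_le _ _
      _ ≤ B + B := add_le_add (hb _) (hb _)
      _ = 2 * B := by ring
  have he0 : e 0 = 0 := slope_eq_zero_of_bounded (K := 2 * B) fun n => by rw [← hdaff]; exact hdb n
  -- so `d` is constant, `w` is affine, and `d 0 = 0`
  have hdc : ∀ n, d n = d 0 := fun n => by rw [hdaff, he0, mul_zero, add_zero]
  have hwaff : ∀ n, w n = w 0 + n * d 0 := by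
    intro n
    induction n using Int.induction_on with
    | zero => simp
    | succ k ih =>
      have h1 : w ((k : ℤ) + 1) = w k + d k := by simp only [hd]; ring
      rw [h1, ih, hdc (k : ℤ)]; push_cast; ring
    | pred k ih =>
      have h1 : w (-(k : ℤ) - 1) = w (-(k : ℤ)) - d (-(k : ℤ) - 1) := by
        simp only [hd]; rw [show -(k : ℤ) - 1 + 1 = -k by ring]; ring
      rw [h1, ih, hdc (-(k : ℤ) - 1)]; push_cast; ring
  have hd0 : d 0 = 0 := slope_eq_zero_of_bounded (K := B) fun n => by rw [← hwaff]; exact hb n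
  intro n
  have := hdc n
  rw [hd0] at this
  exact sub_eq_zero.1 this

/-- **The 1-D spectral lemma at unit spacing.**  A bounded `u : ℤ → ℂ` with `Σ_k u_k c(t − k) = 0`
for all real `t`, `c` continuous and `O((1+|t|)⁻²)`, `𝓕c` of class `C²` and zero-free on
`(1/2, 1) ∪ (−1, −1/2)`, is `2`-periodic. [folklore] -/
theorem rodLemma_one {u : ℤ → ℂ} {c : ℝ → ℂ} {M C : ℝ}
    (hu : ∀ k, ‖u k‖ ≤ M) (hc : Continuous c) (hcd : ∀ t : ℝ, ‖c t‖ ≤ C / (1 + |t|) ^ 2)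
    (hm : ContDiffOn ℝ 2 (𝓕 c) (Set.Ioo (1 / 2 : ℝ) 1 ∪ Set.Ioo (-1 : ℝ) (-(1 / 2))))
    (hm0 : ∀ ξ ∈ Set.Ioo (1 / 2 : ℝ) 1 ∪ Set.Ioo (-1 : ℝ) (-(1 / 2)), 𝓕 c ξ ≠ 0)
    (hsum : ∀ t : ℝ, HasSum (fun k : ℤ => u k * c (t - k)) 0) :
    ∀ k : ℤ, u (k + 2) = u k := by
  have hann : ∀ φ : ℝ → ℂ, ContDiff ℝ 2 φ → HasCompactSupport φ →
      (∀ m : ℤ, φ ((m : ℝ) / 2) = 0 ∧ deriv φ ((m : ℝ) / 2) = 0 ∧ deriv (deriv φ) ((m : ℝ) / 2) = 0) →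
      HasSum (fun k : ℤ => u k * 𝓕 φ k) 0 :=
    fun φ hφ hφs hj => hasSum_mul_fourier_of_jets hu hc hcd hsum hm hm0 hφ hφs hj
  intro k
  -- the subsequence `n ↦ u (k + 2n)` is bounded with vanishing third difference
  set w : ℤ → ℂ := fun n => u (k + 2 * n) with hw
  have hb : ∀ n, ‖w n‖ ≤ M := fun n => hu _
  have h3 : ∀ n, w (n + 3) - 3 * w (n + 2) + 3 * w (n + 1) - w n = 0 := by
    intro n
    have := third_difference_eq_zero hann (k + 2 * n)
    simp only [hw]
    rw [show k + 2 * (n + 3) = k + 2 * n + 6 by ring, show k + 2 * (n + 2) = k + 2 * n + 4 by ring,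
      show k + 2 * (n + 1) = k + 2 * n + 2 by ring]
    exact this
  have := succ_eq_of_third_difference_zero hb h3 0
  simp only [hw] at this
  rwa [mul_zero, add_zero, zero_add, mul_one] at this

/-- **Fourier transform of a dilate**: `𝓕(c(h·))(ξ) = h⁻¹ 𝓕c(ξ/h)` for `h > 0`. [folklore] -/
theorem fourier_comp_mul_left {c : ℝ → ℂ} {h : ℝ} (hh : 0 < h) (ξ : ℝ) :
    𝓕 (fun x => c (h * x)) ξ = (h⁻¹ : ℂ) * 𝓕 c (ξ / h) := by
  simp only [Real.fourier_real_eq, Circle.smul_def, smul_eq_mul]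
  have e : (fun v : ℝ => (𝐞 (-(v * ξ)) : ℂ) * c (h * v)) =
      fun v : ℝ => (fun y : ℝ => (𝐞 (-(y * (ξ / h))) : ℂ) * c y) (h * v) := by
    funext v
    simp only
    congr 3
    field_simp
  rw [e, Measure.integral_comp_mul_left (fun y : ℝ => (𝐞 (-(y * (ξ / h))) : ℂ) * c y) h]
  rw [abs_of_pos (inv_pos.2 hh), Complex.real_smul]
  push_cast
  ring

/-- **STUB 5d of line `signed-root-silent-field` — the 1-D spectral lemma** (registered obligation of
crux `SlackRigidity`, stmt-AtomisticToContinuum-11960).  Let `h > 0`, `u : ℤ → ℂ` bounded,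
`c : ℝ → ℂ` continuous with `|c(t)| ≤ C(1+|t|)⁻²`, and suppose the 1-D Fourier transform `𝓕c` is
`C²` and zero-free on `(1/(2h), 1/h) ∪ (−1/h, −1/(2h))`.  If `Σ_k u_k c(t − kh) = 0` for every
real `t`, then `u` is `2`-periodic.  Proof: scale to `h = 1` (`fourier_comp_mul_left`) and apply
`rodLemma_one` — no Wiener division, no distributions: multiplication formula with test functions
`𝓕(φ/𝓕c)`, a jet argument at the half-integer frequencies, the sampling function `Q₀`, and a
bounded third-difference step. [folklore] -/
theorem stub_rodLemma :
    ∀ (h : ℝ), 0 < h → ∀ (u : ℤ → ℂ) (c : ℝ → ℂ), (∃ M : ℝ, ∀ k, ‖u k‖ ≤ M) → Continuous c →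
    (∃ C : ℝ, ∀ t : ℝ, ‖c t‖ ≤ C / (1 + |t|) ^ 2) →
    ContDiffOn ℝ 2 (𝓕 c) (Set.Ioo (1 / (2 * h)) (1 / h) ∪ Set.Ioo (-(1 / h)) (-(1 / (2 * h)))) →
    (∀ ξ ∈ Set.Ioo (1 / (2 * h)) (1 / h) ∪ Set.Ioo (-(1 / h)) (-(1 / (2 * h))), 𝓕 c ξ ≠ 0) →
    (∀ t : ℝ, HasSum (fun k : ℤ => u k * c (t - k * h)) 0) →
    ∀ k : ℤ, u (k + 2) = u k := by
  intro h hh u c hu hc hcd hm hm0 hsum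
  obtain ⟨M, hM⟩ := hu
  obtain ⟨C, hC⟩ := hcd
  have hC0 : 0 ≤ C := by
    have h0 := hC 0
    simp only [abs_zero, add_zero, one_pow, div_one] at h0
    exact (norm_nonneg _).trans h0
  -- the rescaled kernel
  set c₁ : ℝ → ℂ := fun x => c (h * x) with hc₁
  have hc₁c : Continuous c₁ := hc.comp (continuous_const.mul continuous_id)
  -- decay of `c₁`
  set m₀ : ℝ := min 1 h with hm₀
  have hm₀pos : 0 < m₀ := lt_min one_pos hh
  have hc₁d : ∀ t : ℝ, ‖c₁ t‖ ≤ (C / m₀ ^ 2) / (1 + |t|) ^ 2 := by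
    intro t
    have h1 := hC (h * t)
    have h2 : m₀ * (1 + |t|) ≤ 1 + |h * t| := by
      rw [abs_mul, abs_of_pos hh]
      have := min_le_left 1 h
      have := min_le_right 1 h
      nlinarith [abs_nonneg t]
    have h3 : (m₀ * (1 + |t|)) ^ 2 ≤ (1 + |h * t|) ^ 2 :=
      pow_le_pow_left₀ (by positivity) h2 2
    calc ‖c₁ t‖ = ‖c (h * t)‖ := rfl
      _ ≤ C / (1 + |h * t|) ^ 2 := h1
      _ ≤ C / (m₀ * (1 + |t|)) ^ 2 := div_le_div_of_nonneg_left hC0 (by positivity) h3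
      _ = (C / m₀ ^ 2) / (1 + |t|) ^ 2 := by rw [mul_pow, div_div]
  -- Fourier transform of `c₁`
  have hF : 𝓕 c₁ = fun ξ => (h⁻¹ : ℂ) * 𝓕 c (ξ / h) := funext fun ξ => fourier_comp_mul_left hh ξ
  have hmaps : ∀ ξ ∈ Set.Ioo (1 / 2 : ℝ) 1 ∪ Set.Ioo (-1 : ℝ) (-(1 / 2)),
      ξ / h ∈ Set.Ioo (1 / (2 * h)) (1 / h) ∪ Set.Ioo (-(1 / h)) (-(1 / (2 * h))) := by
    intro ξ hξ
    rcases hξ with ⟨h1, h2⟩ | ⟨h1, h2⟩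
    · left
      constructor
      · rw [show (1 : ℝ) / (2 * h) = (1 / 2) / h by field_simp]
        exact div_lt_div_of_pos_right h1 hh
      · exact div_lt_div_of_pos_right h2 hh
    · right
      constructor
      · rw [show -(1 / h) = (-1 : ℝ) / h by ring]
        exact div_lt_div_of_pos_right h1 hh
      · rw [show -(1 / (2 * h)) = (-(1 / 2) : ℝ) / h by field_simp]
        exact div_lt_div_of_pos_right h2 hh
  have hm₁ : ContDiffOn ℝ 2 (𝓕 c₁) (Set.Ioo (1 / 2 : ℝ) 1 ∪ Set.Ioo (-1 : ℝ) (-(1 / 2))) := by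
    rw [hF]
    refine contDiffOn_const.mul (hm.comp (contDiffOn_id.div_const h) fun ξ hξ => hmaps ξ hξ)
  have hm₁0 : ∀ ξ ∈ Set.Ioo (1 / 2 : ℝ) 1 ∪ Set.Ioo (-1 : ℝ) (-(1 / 2)), 𝓕 c₁ ξ ≠ 0 := by
    intro ξ hξ
    rw [hF]
    exact mul_ne_zero (inv_ne_zero (by exact_mod_cast hh.ne')) (hm0 _ (hmaps ξ hξ))
  -- the identity at unit spacing
  have hsum₁ : ∀ t : ℝ, HasSum (fun k : ℤ => u k * c₁ (t - k)) 0 := by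
    intro t
    have := hsum (h * t)
    convert this using 2 with k
    simp only [hc₁]
    congr 1
    ring
  exact rodLemma_one hM hc₁c hc₁d hm₁ hm₁0 hsum₁

end Summit.AtomisticToContinuum.Crystallization.Theorems.SignedRootRodLemma

end
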